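import Literature.Barriers.PneNP.TSPExtensionComplexityFarkas
import Literature.Computability.Complexity.ExtMonotoneGates
import Mathlib.Algebra.Order.Star.Real
import HarnessLib

/-!
# Crux `Capture` (stmt-PneNP-2659) — duality audit, cell D5: the LP slice of CONV is CLOSED under
# Boolean duality (Farkas certificates, rescaled and linearised, form one LP gate again)

An LP gate (Oliveira–Pudlák's max-right weak MLP gate, feasibility form) accepts `v` iff the system
`{y ≥ 0 : A y ≤ b + B [v]}` is feasible, `B ≥ 0`; it is a CONV gate of width `#rows + #variables` with a
diagonal matrix variable (`isConvGate_of_lp`). Its Boolean DUAL `f^d(v) = ¬ f(¬ v)` accepts `v` iff the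
system at the complementary input, `{y ≥ 0 : A y ≤ b + B [¬v]}`, is INFEASIBLE. By Farkas' lemma (the
tree's algebraic `Literature.Barriers.PneNP.farkas`) infeasibility is witnessed by `z ≥ 0` with `Aᵀ z ≥ 0`
and `zᵀ (b + B[¬v]) < 0`; certificates form a cone, so one may demand `zᵀ(b + B[¬v]) ≤ -1`
(`lp_infeasible_iff_cert`). The bilinear term `zᵀ B [¬v] = Σ_k (1 - [v_k]) (Bᵀz)_k` is linearised by
slack variables `μ_k ≥ 0` and the constraints `(Bᵀ z)_k - μ_k ≤ M [v_k]`, `zᵀ b + Σ_k μ_k ≤ -1`, where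
`M` bounds `(Bᵀ z_v)_k` over ONE chosen certificate `z_v` per input `v` (finitely many inputs — no
compactness needed). The resulting system has non-negative input coefficients on the right-hand sides only,
i.e. it is again an LP gate, with `#rows = q + n + 1` and `#variables = p + n`; hence the dual of an LP
gate of width `p + q` and arity `n` is ONE CONV gate of width `p + q + 2n + 1` (`dualLP_isConvGate`).
This is the LP cell of the duality audit (`Cruxes/Capture/DUALITY-AUDIT-c7.md`), now kernel-checked; the
SDP slice stays open (conic Farkas certifies only strong infeasibility). [folklore; Schrijver 1986 §7.3]
-/

namespace Summit.PneNP.PneNP.Theorems.Capture.DualityAudit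

set_option linter.dupNamespace false -- `Summit.PneNP.PneNP.…`: summit = sub-problem (D-0017)

open Literature.Computability.Complexity Finset Matrix
open Literature.Barriers.PneNP (farkas)

noncomputable section

variable {n : ℕ}

/-- **Every LP gate is a CONV gate** (diagonal matrix variable): if `f v = 1 ↔ ∃ y ≥ 0, A y ≤ b + B [v]`
with rows indexed by `R`, variables by `V` and `B ≥ 0`, then `f` is a CONV gate of width `|R| + |V|`
(Oliveira–Pudlák 2019, Def. 3.1 inside the route's SDP-feasibility class). [folklore] -/
theorem isConvGate_of_lp {R V : Type} [Fintype R] [Fintype V] (A : R → V → ℝ) (b : R → ℝ)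
    (B : R → Fin n → ℝ) (hB : ∀ i k, 0 ≤ B i k) (f : (Fin n → Bool) → Bool)
    (hf : ∀ v, f v = true ↔ ∃ y : V → ℝ, (∀ j, 0 ≤ y j) ∧
      ∀ i, ∑ j, A i j * y j ≤ b i + ∑ k, B i k * (if v k then (1 : ℝ) else 0)) :
    IsConvGate (Fintype.card R + Fintype.card V) ⟨n, f⟩ := by
  classical
  let eR := Fintype.equivFin R
  let eV := Fintype.equivFin V
  refine ⟨Fintype.card R, Fintype.card V, le_rfl,
    fun i => Matrix.diagonal fun j => A (eR.symm i) (eV.symm j), fun i => b (eR.symm i),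
    fun i k => B (eR.symm i) k, fun i k => hB _ _, fun v => ?_⟩
  show f v = true ↔ _
  rw [hf v]
  constructor
  · rintro ⟨y, hy0, hy⟩
    refine ⟨Matrix.diagonal fun j => y (eV.symm j), Matrix.PosSemidef.diagonal fun j => hy0 _, fun i => ?_⟩
    rw [Matrix.diagonal_mul_diagonal, Matrix.trace_diagonal]
    calc ∑ j, A (eR.symm i) (eV.symm j) * y (eV.symm j)
        = ∑ j, A (eR.symm i) j * y j :=
          Fintype.sum_equiv eV.symm _ (fun j => A (eR.symm i) j * y j) fun _ => rfl
      _ ≤ _ := hy (eR.symm i)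
  · rintro ⟨Y, hY, hc⟩
    refine ⟨fun j => Y (eV j) (eV j), fun j => hY.diag_nonneg, fun i => ?_⟩
    have h := hc (eR i)
    simp only [Equiv.symm_apply_apply] at h
    have htr : (Matrix.diagonal (fun j => A i (eV.symm j)) * Y).trace = ∑ j, A i j * Y (eV j) (eV j) := by
      simp only [Matrix.trace, Matrix.diag_apply, Matrix.diagonal_mul]
      exact Fintype.sum_equiv eV.symm _ _ fun j => by simp
    rw [htr] at h
    exact h

/-- Weak LP duality: a Farkas certificate `z ≥ 0`, `Aᵀ z ≥ 0`, `zᵀ c < 0` excludes every `y ≥ 0` with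
`A y ≤ c`. [folklore] -/
theorem lp_infeasible_of_cert {p q : ℕ} (A : Fin p → Fin q → ℝ) (c : Fin p → ℝ) (z : Fin p → ℝ)
    (hz : ∀ i, 0 ≤ z i) (hzA : ∀ j, 0 ≤ ∑ i, A i j * z i) (hzc : ∑ i, z i * c i < 0) :
    ¬ ∃ y : Fin q → ℝ, (∀ j, 0 ≤ y j) ∧ ∀ i, ∑ j, A i j * y j ≤ c i := by
  rintro ⟨y, hy0, hy⟩
  have h1 : ∑ i, z i * (∑ j, A i j * y j) ≤ ∑ i, z i * c i :=
    Finset.sum_le_sum fun i _ => mul_le_mul_of_nonneg_left (hy i) (hz i)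
  have h2 : 0 ≤ ∑ i, z i * (∑ j, A i j * y j) := by
    have : ∑ i, z i * (∑ j, A i j * y j) = ∑ j, (∑ i, A i j * z i) * y j := by
      simp only [Finset.mul_sum, Finset.sum_mul]
      rw [Finset.sum_comm]
      exact Finset.sum_congr rfl fun j _ => Finset.sum_congr rfl fun i _ => by ring
    rw [this]
    exact Finset.sum_nonneg fun j _ => mul_nonneg (hzA j) (hy0 j)
  linarith

/-- **Farkas, LP form, rescaled**: `{y ≥ 0 : A y ≤ c}` is infeasible iff some `z ≥ 0` has `Aᵀ z ≥ 0`
and `zᵀ c ≤ -1` (certificates form a cone; from the conic `farkas` of the tree with generators the columns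
of `A` and the unit vectors). [folklore; Schrijver 1986 Cor. 7.1e] -/
theorem lp_infeasible_iff_cert {p q : ℕ} (A : Fin p → Fin q → ℝ) (c : Fin p → ℝ) :
    (¬ ∃ y : Fin q → ℝ, (∀ j, 0 ≤ y j) ∧ ∀ i, ∑ j, A i j * y j ≤ c i) ↔
      ∃ z : Fin p → ℝ, (∀ i, 0 ≤ z i) ∧ (∀ j, 0 ≤ ∑ i, A i j * z i) ∧ ∑ i, z i * c i ≤ -1 := by
  classical
  constructor
  · intro hinf
    -- generators: columns of `A` and unit vectors; target `c`
    rcases farkas (κ := Fin p) (Sum.elim (fun j : Fin q => fun i => A i j)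
        (fun i' : Fin p => (Pi.single i' 1 : Fin p → ℝ))) c with ⟨lam, hlam, hc⟩ | ⟨w, hw, hcw⟩
    · exfalso
      refine hinf ⟨fun j => lam (Sum.inl j), fun j => hlam _, fun i => ?_⟩
      rw [hc i, Fintype.sum_sum_type]
      simp only [Sum.elim_inl, Sum.elim_inr, Pi.single_apply]
      have h2 : ∑ i', lam (Sum.inr i') * (if i = i' then (1 : ℝ) else 0) = lam (Sum.inr i) := by
        rw [Finset.sum_eq_single i (fun i' _ hne => by rw [if_neg (Ne.symm hne), mul_zero])
          (fun h => absurd (Finset.mem_univ i) h), if_pos rfl, mul_one]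
      rw [h2]
      have h3 : ∑ j, A i j * lam (Sum.inl j) = ∑ j, lam (Sum.inl j) * A i j :=
        Finset.sum_congr rfl fun j _ => mul_comm _ _
      linarith [hlam (Sum.inr i)]
    · -- rescale the certificate `w` to `zᵀ c = -1`
      have hw0 : ∀ i, 0 ≤ w i := fun i => by
        have := hw (Sum.inr i)
        simpa [dotProduct, Pi.single_apply] using this
      have hwA : ∀ j, 0 ≤ ∑ i, A i j * w i := fun j => by
        have := hw (Sum.inl j)
        simpa [dotProduct] using this
      have hs : c ⬝ᵥ w < 0 := hcw
      set s := c ⬝ᵥ w with hs_def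
      have hspos : 0 < -s := by linarith
      refine ⟨fun i => (-s)⁻¹ * w i, fun i => mul_nonneg (inv_nonneg.2 hspos.le) (hw0 i), fun j => ?_, ?_⟩
      · have : ∑ i, A i j * ((-s)⁻¹ * w i) = (-s)⁻¹ * ∑ i, A i j * w i := by
          rw [Finset.mul_sum]
          exact Finset.sum_congr rfl fun i _ => by ring
        rw [this]
        exact mul_nonneg (inv_nonneg.2 hspos.le) (hwA j)
      · have : ∑ i, (-s)⁻¹ * w i * c i = (-s)⁻¹ * (c ⬝ᵥ w) := by
          simp only [dotProduct, Finset.mul_sum]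
          exact Finset.sum_congr rfl fun i _ => by ring
        rw [this, ← hs_def, show (-s)⁻¹ * s = -((-s)⁻¹ * (-s)) by ring, inv_mul_cancel₀ hspos.ne']
  · rintro ⟨z, hz, hzA, hzc⟩
    exact lp_infeasible_of_cert A c z hz hzA (by linarith)

/-- **Duality-audit cell D5 (registered sub-goal `dualLP_isConvGate`)**: the Boolean DUAL of an LP gate
— `f v = 1 ↔ {y ≥ 0 : A y ≤ b + B [¬ v]}` is INFEASIBLE (`B ≥ 0`, `p` rows, `q` variables, arity `n`) — is
ONE CONV gate of width `p + q + 2n + 1`: the LP in the certificate variables `z ≥ 0` and slacks `μ ≥ 0`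
with rows `-(Aᵀz)_j ≤ 0`, `(Bᵀz)_k - μ_k ≤ M [v_k]`, `zᵀ b + Σ_k μ_k ≤ -1`, where `M` bounds one chosen
rescaled Farkas certificate per input. [folklore] -/
theorem dualLP_isConvGate : ∀ (n p q : ℕ) (A : Fin p → Fin q → ℝ) (b : Fin p → ℝ)
    (B : Fin p → Fin n → ℝ), (∀ i k, 0 ≤ B i k) → ∀ f : (Fin n → Bool) → Bool,
    (∀ v, f v = true ↔ ¬ ∃ y : Fin q → ℝ, (∀ j, 0 ≤ y j) ∧
      ∀ i, ∑ j, A i j * y j ≤ b i + ∑ k, B i k * (if v k then (0 : ℝ) else 1)) →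
    IsConvGate (p + q + 2 * n + 1) ⟨n, f⟩ := by
  intro n p q A b B hB f hf
  classical
  -- the complementary right-hand side and the infeasibility predicate
  let c : (Fin n → Bool) → Fin p → ℝ := fun v i => b i + ∑ k, B i k * (if v k then (0 : ℝ) else 1)
  have hcert : ∀ v, f v = true → ∃ z : Fin p → ℝ, (∀ i, 0 ≤ z i) ∧ (∀ j, 0 ≤ ∑ i, A i j * z i) ∧
      ∑ i, z i * c v i ≤ -1 := fun v hv => (lp_infeasible_iff_cert A (c v)).1 ((hf v).1 hv)
  -- one chosen certificate per accepted input, and a common bound `M` on `Bᵀ z`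
  let zc : (Fin n → Bool) → Fin p → ℝ := fun v => if hv : f v = true then Classical.choose (hcert v hv) else 0
  have hzc0 : ∀ v i, 0 ≤ zc v i := fun v i => by
    simp only [zc]
    split_ifs with hv
    · exact (Classical.choose_spec (hcert v hv)).1 i
    · exact le_rfl
  have hzcA : ∀ v, f v = true → ∀ j, 0 ≤ ∑ i, A i j * zc v i := fun v hv j => by
    simp only [zc, dif_pos hv]
    exact (Classical.choose_spec (hcert v hv)).2.1 j
  have hzcc : ∀ v, f v = true → ∑ i, zc v i * c v i ≤ -1 := fun v hv => by
    simp only [zc, dif_pos hv]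
    exact (Classical.choose_spec (hcert v hv)).2.2
  let M : ℝ := ∑ v : Fin n → Bool, ∑ k : Fin n, ∑ i, B i k * zc v i
  have hBz0 : ∀ v k, 0 ≤ ∑ i, B i k * zc v i := fun v k =>
    Finset.sum_nonneg fun i _ => mul_nonneg (hB i k) (hzc0 v i)
  have hM : ∀ v k, ∑ i, B i k * zc v i ≤ M := fun v k =>
    calc ∑ i, B i k * zc v i ≤ ∑ k', ∑ i, B i k' * zc v i :=
          Finset.single_le_sum (f := fun k' => ∑ i, B i k' * zc v i) (fun k' _ => hBz0 v k')
            (Finset.mem_univ k)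
      _ ≤ M := Finset.single_le_sum (f := fun v' => ∑ k', ∑ i, B i k' * zc v' i)
            (fun v' _ => Finset.sum_nonneg fun k' _ => hBz0 v' k') (Finset.mem_univ v)
  have hM0 : 0 ≤ M := Finset.sum_nonneg fun v _ => Finset.sum_nonneg fun k _ => hBz0 v k
  -- the dual LP: rows `Fin q ⊕ Fin n ⊕ Unit`, variables `Fin p ⊕ Fin n`
  let A' : Fin q ⊕ Fin n ⊕ Unit → Fin p ⊕ Fin n → ℝ := fun r w => match r, w with
    | Sum.inl j, Sum.inl i => -A i j
    | Sum.inl _, Sum.inr _ => 0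
    | Sum.inr (Sum.inl k), Sum.inl i => B i k
    | Sum.inr (Sum.inl k), Sum.inr k' => if k' = k then -1 else 0
    | Sum.inr (Sum.inr _), Sum.inl i => b i
    | Sum.inr (Sum.inr _), Sum.inr _ => 1
  let b' : Fin q ⊕ Fin n ⊕ Unit → ℝ := fun r => match r with
    | Sum.inl _ => 0
    | Sum.inr (Sum.inl _) => 0
    | Sum.inr (Sum.inr _) => -1
  let B' : Fin q ⊕ Fin n ⊕ Unit → Fin n → ℝ := fun r k' => match r with
    | Sum.inl _ => 0
    | Sum.inr (Sum.inl k) => if k' = k then M else 0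
    | Sum.inr (Sum.inr _) => 0
  have hB' : ∀ r k', 0 ≤ B' r k' := by
    rintro (j | k | u) k' <;> simp only [B'] <;> try exact le_rfl
    split_ifs
    · exact hM0
    · exact le_rfl
  have hwidth : Fintype.card (Fin q ⊕ Fin n ⊕ Unit) + Fintype.card (Fin p ⊕ Fin n) = p + q + 2 * n + 1 := by
    simp only [Fintype.card_sum, Fintype.card_fin, Fintype.card_unit]
    ring
  rw [← hwidth]
  refine isConvGate_of_lp A' b' B' hB' f fun v => ?_
  -- bookkeeping: the rows of the dual LP evaluated at `y' = (z, μ)`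
  have hind : ∀ k, (∑ k', (if k' = k then M else 0) * (if v k' then (1 : ℝ) else 0)) =
      M * (if v k then 1 else 0) := fun k => by
    rw [Finset.sum_eq_single k (fun k' _ hne => by rw [if_neg hne, zero_mul])
      (fun h => absurd (Finset.mem_univ k) h), if_pos rfl]
  have hrow1 : ∀ (y' : Fin p ⊕ Fin n → ℝ) (j : Fin q),
      (∑ w, A' (Sum.inl j) w * y' w ≤ b' (Sum.inl j) + ∑ k', B' (Sum.inl j) k' * (if v k' then (1 : ℝ) else 0))
        ↔ 0 ≤ ∑ i, A i j * y' (Sum.inl i) := fun y' j => by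
    simp only [A', b', B', Fintype.sum_sum_type, zero_mul, Finset.sum_const_zero, add_zero, neg_mul,
      Finset.sum_neg_distrib]
    constructor <;> intro h <;> linarith
  have hrow2 : ∀ (y' : Fin p ⊕ Fin n → ℝ) (k : Fin n),
      (∑ w, A' (Sum.inr (Sum.inl k)) w * y' w ≤ b' (Sum.inr (Sum.inl k)) +
          ∑ k', B' (Sum.inr (Sum.inl k)) k' * (if v k' then (1 : ℝ) else 0))
        ↔ ∑ i, B i k * y' (Sum.inl i) - y' (Sum.inr k) ≤ M * (if v k then 1 else 0) := fun y' k => by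
    simp only [A', b', B', Fintype.sum_sum_type, zero_add, hind]
    have h2 : ∑ k', (if k' = k then (-1 : ℝ) else 0) * y' (Sum.inr k') = -y' (Sum.inr k) := by
      rw [Finset.sum_eq_single k (fun k' _ hne => by rw [if_neg hne, zero_mul])
        (fun h => absurd (Finset.mem_univ k) h), if_pos rfl, neg_one_mul]
    rw [h2, ← sub_eq_add_neg]
  have hrow3 : ∀ (y' : Fin p ⊕ Fin n → ℝ) (u : Unit),
      (∑ w, A' (Sum.inr (Sum.inr u)) w * y' w ≤ b' (Sum.inr (Sum.inr u)) +
          ∑ k', B' (Sum.inr (Sum.inr u)) k' * (if v k' then (1 : ℝ) else 0))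
        ↔ ∑ i, b i * y' (Sum.inl i) + ∑ k, y' (Sum.inr k) ≤ -1 := fun y' u => by
    simp only [A', b', B', Fintype.sum_sum_type, one_mul, zero_mul, Finset.sum_const_zero, add_zero]
  -- `zᵀ c(v) = zᵀ b + Σ_k [¬v_k] (Bᵀ z)_k`
  have hzc_expand : ∀ z : Fin p → ℝ, ∑ i, z i * c v i =
      ∑ i, b i * z i + ∑ k, (if v k then (0 : ℝ) else 1) * ∑ i, B i k * z i := fun z => by
    simp only [c, mul_add, Finset.sum_add_distrib, Finset.mul_sum]
    congr 1
    · exact Finset.sum_congr rfl fun i _ => mul_comm _ _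
    · rw [Finset.sum_comm]
      exact Finset.sum_congr rfl fun k _ => Finset.sum_congr rfl fun i _ => by ring
  constructor
  · -- an accepted input: the chosen certificate and the slacks `μ_k = [¬v_k] (Bᵀ z)_k` are feasible
    intro hv
    refine ⟨Sum.elim (zc v) fun k => (if v k then (0 : ℝ) else 1) * ∑ i, B i k * zc v i, ?_, ?_⟩
    · rintro (i | k)
      · exact hzc0 v i
      · simp only [Sum.elim_inr]
        exact mul_nonneg (by split_ifs <;> norm_num) (hBz0 v k)
    · rintro (j | k | u)
      · rw [hrow1]
        exact hzcA v hv j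
      · rw [hrow2]
        simp only [Sum.elim_inl, Sum.elim_inr]
        cases v k
        · simp
        · simp only [if_true, zero_mul, sub_zero, mul_one]
          exact hM v k
      · rw [hrow3]
        simp only [Sum.elim_inl, Sum.elim_inr]
        rw [← hzc_expand]
        exact hzcc v hv
  · -- a feasible `(z, μ)` is a Farkas certificate at the complementary input
    rintro ⟨y', hy'0, hy'⟩
    rw [hf v]
    refine lp_infeasible_of_cert A (c v) (fun i => y' (Sum.inl i)) (fun i => hy'0 _)
      (fun j => (hrow1 y' j).1 (hy' (Sum.inl j))) ?_
    have h3 := (hrow3 y' ()).1 (hy' (Sum.inr (Sum.inr ())))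
    have hk : ∀ k, (if v k then (0 : ℝ) else 1) * ∑ i, B i k * y' (Sum.inl i) ≤ y' (Sum.inr k) := fun k => by
      have h2 := (hrow2 y' k).1 (hy' (Sum.inr (Sum.inl k)))
      have hμ := hy'0 (Sum.inr k)
      cases hvk : v k
      · rw [hvk] at h2
        simp only [Bool.false_eq_true, if_false, one_mul, mul_zero] at h2 ⊢
        linarith
      · simp only [if_true, zero_mul]
        exact hμ
    rw [hzc_expand]
    have := Finset.sum_le_sum fun k (_ : k ∈ Finset.univ) => hk k
    linarith

end

end Summit.PneNP.PneNP.Theorems.Capture.DualityAudit
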